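import Literature.AlgebraicGeometry.AbelianSchemes.PDivisibleGroupFunctor          -- ★ `torsionMap`, `torsionMap_ι`, `pDivisibleGroupMap{,_app,_id,_comp}`
import Literature.AlgebraicGeometry.AbelianSchemes.AbelianSchemeOverRingAction     -- ★ `AbelianSchemeOver.RingAction` (`act.i`, `i_one`, `i_mul`, `i_add`)
import Literature.AlgebraicGeometry.GroupSchemes.BTGroupNilpotentPoints             -- ★ `IsRingActionBT`
import HarnessLib

/-!
# The `p`-divisible group of an abelian scheme inherits a ring action ([Tate 1967] §2.2; [Kottwitz 1992] §5)

Topic `Literature/AlgebraicGeometry/AbelianSchemes`; namespace `Literature.AlgebraicGeometry.AbelianSchemes.AbelianSchemeOver`.  THEOREMS ONLY;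
no definition, no named fact, no instance, no notation, no `sorry`.  Cell `hodgecm-mathlib` (D-0151), P6 «MOD programme», K∕BT desk F0P6d-plan
(g2), K∕BT CUT v2 «BLOCK-AT-A-POINT» DEAL 3 (memo `F0/P6/F0P6d-plan/KBT-CUT.v2.F0P6dplan-g2.md` §2): step (Σ3a) of the chain at a special point —
the ring action `ι : 𝒪 → End_S(A)` of ★ `AbelianSchemeOver.RingAction` passes to the Barsotti–Tate group `A[p^∞]` (★ `pDivisibleGroup`) through
the functor ★ `pDivisibleGroupMap`, AS A RING ACTION in the sense of ★ `GroupSchemes.IsRingActionBT` (the currency of the ★-boxed P6b kit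
`blockNumerics_of_line`, binder `hβ`).  HC_CM is proved only modulo the printed citations until rung 0 closes; nothing here is about HC.

THE PRINT.  [Tate1967] §2.2: `A ↦ A(p)` is a functor, so `End(A)` acts on `A(p)`; with (2.1) the layers `A[pⁿ] = Ker [pⁿ]` are subgroup schemes
on which a homomorphism `u` acts by restriction `u[pⁿ]` (★ `torsionMap`, `torsionMap_ι : u[pⁿ] ≫ ι = ι ≫ u`).  [Kottwitz1992] §5 (p. 390): the
`𝒪_B`-action on the abelian scheme induces one on its `p`-divisible group.  The one non-formal line: the SUM of two endomorphisms restricts to the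
sum of the restrictions — the layer inclusion `ι` is a homomorphism (★ `isMonHom_torsionι`), so `(u * v)[N] = u[N] * v[N]` (`torsionMap_mul`).

MAIN STATEMENTS.  §1 `torsionMap_mul` (any base `S`, commutative target): `(f * g)[N] = lift f[N] g[N] ≫ μ`; §2 (base `Spec R`)
**`RingAction.isRingActionBT_pDivisibleGroupMap : IsRingActionBT (A.pDivisibleGroup hp hg) (fun a => pDivisibleGroupMap (act.i a) hp hg hg)`**, with the
layer formula `RingAction.pDivisibleGroupMap_i_app_comp_ι`.

## References
* [Tate1967] J. T. Tate, *p-divisible groups*, Proc. Conf. Local Fields (Driebergen, 1966), Springer (1967), §2 (2.1), §2.2.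
* [Kottwitz1992] R. E. Kottwitz, *Points on some Shimura varieties over finite fields*, J. Amer. Math. Soc. 5 (1992), §5 (p. 390).
-/

set_option autoImplicit false

noncomputable section

universe u v

open CategoryTheory CategoryTheory.Limits AlgebraicGeometry MonoidalCategory CartesianMonoidalCategory
open scoped MonObj

namespace Literature.AlgebraicGeometry.AbelianSchemes

namespace AbelianSchemeOver

open Literature.AlgebraicGeometry.GroupSchemes

/-! ## §1 The layer of a product of homomorphisms is the product of the layers -/

section TorsionMul

variable {S : Scheme.{u}} {A A' : AbelianSchemeOver S} [IsCommMonObj A'.X]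

/-- **`(f * g)[N] = f[N] * g[N]`**: for homomorphisms `f g : A → A'` whose pointwise product `f * g` is again a homomorphism (always, for
commutative `A'`: ★ `isMonHom_mul`), the restriction of `f * g` to the `N`-torsion is the pointwise product `lift f[N] g[N] ≫ μ` of the restrictions
for the kernel group law ★ `torsionGrpObj` — because the inclusion `ι : A'[N] ↪ A'` is a monomorphic homomorphism. [cite: Tate1967, §2 (2.1)] -/
theorem torsionMap_mul (f g : A.X ⟶ A'.X) [IsMonHom f] [IsMonHom g] [IsMonHom (f * g)] (N : ℕ) :
    letI := A'.torsionGrpObj N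
    torsionMap (f * g) N = lift (torsionMap f N) (torsionMap g N) ≫ μ[A'.torsion N] := by
  letI := A'.torsionGrpObj N
  haveI := A'.isMonHom_torsionι N
  apply A'.torsion_hom_ext
  rw [torsionMap_ι, MonObj.comp_mul, Hom.mul_def, Category.assoc, IsMonHom.mul_hom, lift_map_assoc, torsionMap_ι, torsionMap_ι]

end TorsionMul

/-! ## §2 `A[p^∞]` inherits the ring action -/

namespace RingAction

variable {R : Type u} [CommRing R] {A : AbelianSchemeOver (Spec (.of R))} [IsCommMonObj A.X] {O : Type v} [CommRing O]
  (act : RingAction O A) {p g : ℕ} (hp : p ≠ 0) (hg : A.IsOfRelDim g)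

/-- Layer formula: `(ι a)[p^∞]_n ≫ incl = incl ≫ ι a` on `A[pⁿ] ↪ A`. [cite: Tate1967, §2 (2.1)] -/
theorem pDivisibleGroupMap_i_app_comp_ι (a : O) (n : ℕ) :
    (haveI := act.isMonHom_i a; pDivisibleGroupMap (act.i a) hp hg hg).app n ≫ A.torsionι (p ^ n) = A.torsionι (p ^ n) ≫ act.i a := by
  haveI := act.isMonHom_i a
  exact pDivisibleGroupMap_app_comp_ι (act.i a) hp hg hg n

/-- **`A[p^∞]` INHERITS THE RING ACTION**: for a ring action `act : RingAction O A` on an abelian scheme `A → Spec R` (commutative group law, relative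
dimension `g`) and `p ≠ 0`, `a ↦ (act.i a)[p^∞]` (★ `pDivisibleGroupMap`) is a ring action on the Barsotti–Tate group `A[p^∞]` in the sense of
★ `IsRingActionBT`: `1 ↦ id` (★ `pDivisibleGroupMap_id`), `ab ↦ (b-th) ≫ (a-th)` (★ `pDivisibleGroupMap_comp`, `act.i (a * b) = act.i b ≫ act.i a`;
★ `Hom.comp` is diagrammatic), and `a + b ↦` the layer-wise pointwise product (§1 `torsionMap_mul` shape, `act.i (a + b) = act.i a * act.i b`).
[cite: Tate1967, §2.2] [cite: Kottwitz1992, §5 (p. 390)] -/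
theorem isRingActionBT_pDivisibleGroupMap :
    IsRingActionBT (A.pDivisibleGroup hp hg) (fun a => haveI := act.isMonHom_i a; pDivisibleGroupMap (act.i a) hp hg hg) := by
  refine ⟨?_, fun a b => ?_, fun a b n => ?_⟩
  · -- `1 ↦ id`
    refine BTGroup.Hom.ext fun n => ?_
    haveI := act.isMonHom_i 1
    show torsionMap (act.i 1) (p ^ n) = 𝟙 (A.torsion (p ^ n))
    apply A.torsion_hom_ext
    rw [torsionMap_ι, act.i_one, Category.comp_id, Category.id_comp]
  · -- `ab ↦ (b-th) ≫ (a-th)`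
    refine BTGroup.Hom.ext fun n => ?_
    haveI := act.isMonHom_i a; haveI := act.isMonHom_i b; haveI := act.isMonHom_i (a * b)
    show torsionMap (act.i (a * b)) (p ^ n) = torsionMap (act.i b) (p ^ n) ≫ torsionMap (act.i a) (p ^ n)
    apply A.torsion_hom_ext
    rw [torsionMap_ι, act.i_mul, Category.assoc, torsionMap_ι, torsionMap_ι_assoc]
  · -- `a + b ↦` pointwise product on the layer
    letI := A.torsionGrpObj (p ^ n)
    haveI : IsMonHom (A.torsionι (p ^ n)) := A.isMonHom_torsionι (p ^ n)
    haveI := act.isMonHom_i a; haveI := act.isMonHom_i b; haveI := act.isMonHom_i (a + b)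
    show torsionMap (act.i (a + b)) (p ^ n) = lift (torsionMap (act.i a) (p ^ n)) (torsionMap (act.i b) (p ^ n)) ≫ μ[A.torsion (p ^ n)]
    apply A.torsion_hom_ext
    rw [torsionMap_ι, act.i_add, MonObj.comp_mul, Hom.mul_def, Category.assoc, IsMonHom.mul_hom, lift_map_assoc, torsionMap_ι, torsionMap_ι]

end RingAction

end AbelianSchemeOver

end Literature.AlgebraicGeometry.AbelianSchemes

end
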